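import Literature.MathematicalPhysics.QuantumFieldTheory.Balaban1983to89.Beta.SquareTableSlots
import Literature.MathematicalPhysics.QuantumFieldTheory.Balaban1983to89.Beta.HidentScalewise

/-!
# `Balaban1983to89.Beta.SquareTableSlotsScalewise` — THE SLOT-FAMILIES TABLE SIDE JOINED TO THE SCALE-WISE FORM OF THE (D1) BINDER

(β sub-cell of pub-balaban, row BETA-an3 gen 9, node BETA-an3-g9-SLOTSCALEWISE; a by-name join of `Beta.SquareTableSlots` (this row, p184314)
with `Beta.HidentScalewise` (row BETA-an2 gen 6, p184266): nothing new is proved about either side.)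

HONEST FRAMING (mandatory, page 1).  «discharging `BetaPertH` makes Bałaban's UV stability UNCONDITIONAL — a real
constructive-QFT result; it is NOT the continuum limit and NOT the Clay problem.»  Gloss 1 (the LEAD's, BETA-SPEC §0):
«unconditional» means the coupling-window HYPOTHESIS of [Balaban1989LargeFieldII] (B16) p. 355's one displayed END STATEMENT is
discharged INSIDE THE LATTICE RENORMALIZATION PROGRAMME; every other input remains a verbatim QUOTATION of Bałaban's printed
theorems — the result is «B16's theorem with one hypothesis fewer», not a first-principles formalisation of B5–B16.  Gloss 2: the
object is the `EventualForm`-unconditional END statement, NOT «Theorem 2 as printed».  Gloss 3″ (v1.9r §7.20 (c), binding): the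
interval hypothesis of [Balaban1987RG1] Thm 2 p. 259 is REPLACED by the (R10-1′) carrier of PARTIAL SUMS; what is made
unconditional is an END STATEMENT under the explicit γ-smallness restrictions of the kernel binders — never «Theorem 2 as printed»,
never the continuum limit / mass gap / Clay.  NOTHING in this module is summit progress: it is [folklore] composition of two landed
modules and asserts nothing about Bałaban's propagators or Hessian kernels.

ABSOLUTE RULE (cell charter, verbatim in substance).  No internally-minted statement enters as a cited fact: every hypothesis of every
theorem below is an explicit binder; NOTHING is cited.  The manuscripts under audit appear only as CONTEXT.  READING CLAUSE inherited
from `HidentScalewise`: the identification of `wK`, `T j`, `𝒯 m` with Bałaban's U = 1 minimiser and one-step / one-shot Hessian kernels is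
the sub-cell's READING (BETA/AN2.md §12, DICT-KKT) — a dictionary, never a hypothesis, never proved, never cited.

WHAT IS DERIVED ([folklore] throughout).
* §1 `composedCoeff_head`: the composed coefficient of the marginal family `μC j k := if j = 0 then a k else 0` at `m ≥ 1` is `a m` — any
  sequence is a composed coefficient, so `SquareTableSlots.hident_of_slotFullSum_avg` (stated for `composedCoeff μC m`) truncates ANY
  full-sum comparison; **`oneShotRepresentation_of_slotFullSum`**: a ONE-SHOT FULL-SUM comparison
  `|F (m2Tensor (𝒯 m)) − Σ_b wt_b·fullSum (stKc …_{Lc^m,b})| ≤ U` (`m ≥ 1`) plus the slot-wise leg tails gives an2's (I2-rep)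
  `HidentScalewise.OneShotRepresentation Lc F 𝒯 univ (cpCoeff N ω) μ ν Bset wt F′ G′ M (U + ε)` for the slot legs
  `F′_b (i,κ) n = stP_i(GP_{n,b}(i,κ))`, `G′_b (i,κ) n = stQ_i(GQ_{n,b}(i,κ))` — the window radius per scale is chosen by the truncation.
* §2 **`oneLoopDrift_of_slotRows_scalewise`** / **`endpointExistence_of_slotRows_scalewise_remainderConst`** (+ `…_of_symmetries`):
  `HidentScalewise.oneLoopDrift_of_scalewise` / `endpointExistence_of_scalewise_remainderConst(_of_symmetries)` — generic in the table and the
  legs — AT the copy-enlarged realised table `(univ, cpCoeff N ω, cpP, cpQ)` (`SquareTableSlots.hdeg_cp`, `hval_cp`: `κ = kappaBal N` exactly)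
  with the slot-wise adapters `SquareTableSlots.hF/hG/hFtail/hGtail_slots_avg`: hypotheses = an2's scale-wise one-loop data (`T`, `𝒯`,
  `AbsMoment₂`, (T0)/(T1) or the two symmetries, additive read-out `F`, `hβ : β⁰_j = F (m2Tensor (T j))`, (N1-B) `HessianTelescoping`), the six
  graded rows (`WindowRows`/`DecayRows`) of EVERY slot kernel per base point with constants free of slot, copy and base point, window data,
  (I2-rep) `OneShotRepresentation` for the slot legs (or, via §1, the one-shot full-sum comparison: `…_of_slotFullSum_scalewise`), and for the
  END statements the downstream binders verbatim (`RemainderConst`, `rr ≤ stepBal`, `BetaContH`, `BetaUpperH`, `ForwardGenerated`).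
  Conclusion `OneLoopDrift (stepBal N Lc) (constA …) cc (kappaBal N·transverseValue) Sβ.β0` (an2's constant at the cp table) resp.
  `EndpointExistence Cn`.

WHAT IS NOT TOUCHED (located, by name): (N1-B) `HessianTelescoping` and (I2-rep) for Bałaban's kernels (an2 / lead); the six rows of the slot
kernels (an1 / an4 / an5); `RemainderConst` ((D4), the (β) leaf); `BetaContH` ((D5)); which kernel feeds which slot (the (D1) side's choice).

Sources (CONTEXT only; nothing of them is used): [Balaban1987RG1] (INDEX B12) p. 264 (1.20)–(1.22); [Balaban1984PropagatorsI] p. 31 (1.83);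
[Balaban1989LargeFieldII] (INDEX B16) p. 355.  Tags: [folklore].  No `axiom`, no `sorry`.  v1 (2026-08-19, unit `b2b-balaban-beta-an3-g9`).
-/

noncomputable section

namespace Literature.MathematicalPhysics.QuantumFieldTheory.Balaban1983to89.Beta.SquareTableSlotsScalewise

open Finset
open scoped BigOperators
open Literature.Probability.LatticeModels (annulus)
open Literature.MathematicalPhysics.QuantumFieldTheory.Balaban1983to89
open FlowStep FlowStepRuns DagBinding
open Literature.MathematicalPhysics.QuantumFieldTheory.Balaban1983to89.Beta.TransverseStructure (E4)
open Literature.MathematicalPhysics.QuantumFieldTheory.Balaban1983to89.Beta.LeadingCoefficient (leadingIntegrand kappaBal transverseValue)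
open Literature.MathematicalPhysics.QuantumFieldTheory.Balaban1983to89.Beta.DyadicShell (Pt toReal supNorm)
open Literature.MathematicalPhysics.QuantumFieldTheory.Balaban1983to89.Beta.BubbleTransfer (Leg contBubble bubbleConst)
open Literature.MathematicalPhysics.QuantumFieldTheory.Balaban1983to89.Beta.Drift (OneLoopDrift)
open Literature.MathematicalPhysics.QuantumFieldTheory.Balaban1983to89.Beta.RemainderChain (RemainderConst)
open Literature.MathematicalPhysics.QuantumFieldTheory.Balaban1983to89.Beta.MarginalTelescoping (composedCoeff IdentityForm)
open Literature.MathematicalPhysics.QuantumFieldTheory.Balaban1983to89.Beta.LargeLWindow.WindowDecomposition (constA)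
open Literature.MathematicalPhysics.QuantumFieldTheory.Balaban1983to89.Beta.WindowIdentification (fullSum)
open Literature.MathematicalPhysics.QuantumFieldTheory.Balaban1983to89.Beta.GhostTable (gFree)
open Literature.MathematicalPhysics.QuantumFieldTheory.Balaban1983to89.Beta.SquareTable (BfIdx bfCoeff bfP bfQ stP stQ)
open Literature.MathematicalPhysics.QuantumFieldTheory.Balaban1983to89.Beta.SquareTableSlots
open Literature.MathematicalPhysics.QuantumFieldTheory.Balaban1983to89.Beta.HidentScalewise
open DecimatedMomentSummable (AbsMoment₂)
open DressedMomentNormalisation (EKer m2Tensor)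

variable {μ ν : Fin 4} {K : Type*} [Fintype K] {κB : Type*}

/-! ## §1 Any sequence is a composed coefficient; (I2-rep) from a one-shot full-sum comparison -/

omit [Fintype K] in
/-- the composed coefficient of the marginal family supported on `j = 0` is the sequence itself (`m ≥ 1`). [folklore] -/
theorem composedCoeff_head (a : ℕ → ℝ) {m : ℕ} (hm : 1 ≤ m) :
    composedCoeff (fun j k => if j = 0 then a k else 0) m = a m := by
  unfold composedCoeff
  rw [Finset.sum_ite_eq' (Finset.range m) 0 (fun _ => a m)]
  simp [Finset.mem_range, show 0 < m from hm]

/-- **(I2-rep) FROM A ONE-SHOT FULL-SUM COMPARISON AND THE SLOT TAILS**: `|F (m2Tensor (𝒯 m)) − Σ_b wt_b·fullSum (stKc …_{Lc^m,b})| ≤ U` for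
`m ≥ 1`, slot-wise leg tails with constants free of slot, copy and base point ⟹ an2's `OneShotRepresentation` for the slot legs at `U + ε`
(`SquareTableSlots.hident_of_slotFullSum_avg` read through `composedCoeff_head`). [folklore] -/
theorem oneShotRepresentation_of_slotFullSum (hμν : μ ≠ ν) {N : ℝ} {Lc : ℕ} (hL : 2 ≤ Lc) {ω : BfIdx → K → ℝ}
    {Bset : ℕ → Finset κB} {wt : ℕ → κB → ℝ} {GP GQ : ℕ → κB → BfIdx × K → Pt → ℝ} {R' S' : BfIdx × K → ℝ} {δ U : ℝ} {M : ℕ → ℕ}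
    (hwt0 : ∀ n : ℕ, 2 ≤ n → ∀ b ∈ Bset n, 0 ≤ wt n b) (hwt1 : ∀ n : ℕ, 2 ≤ n → ∑ b ∈ Bset n, wt n b = 1)
    (hR' : ∀ p ∈ (Finset.univ : Finset (BfIdx × K)), 0 ≤ R' p) (hS' : ∀ p ∈ (Finset.univ : Finset (BfIdx × K)), 0 ≤ S' p)
    (hδ : 0 < δ)
    (hFtail : ∀ m : ℕ, 1 ≤ m → ∀ b ∈ Bset (Lc ^ m), ∀ r : ℕ, M (Lc ^ m) ≤ r → ∀ w ∈ annulus 4 r (r + 1),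
      ∀ p ∈ (Finset.univ : Finset (BfIdx × K)),
      |stP μ ν (GP (Lc ^ m) b p) p.1 w| ≤ R' p / ((r : ℝ) + 1) ^ (bfP hμν p.1).a * Real.exp (-(δ / ((Lc ^ m : ℕ) : ℝ)) * ((r : ℝ) + 1)))
    (hGtail : ∀ m : ℕ, 1 ≤ m → ∀ b ∈ Bset (Lc ^ m), ∀ r : ℕ, M (Lc ^ m) ≤ r → ∀ w ∈ annulus 4 r (r + 1),
      ∀ p ∈ (Finset.univ : Finset (BfIdx × K)), |stQ μ ν (GQ (Lc ^ m) b p) p.1 w| ≤ S' p / ((r : ℝ) + 1) ^ (bfQ hμν p.1).a)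
    {F : Tensor4 → ℝ} {𝒯 : ℕ → EKer 4}
    (hU : ∀ m : ℕ, 1 ≤ m →
      |F (m2Tensor (𝒯 m)) - ∑ b ∈ Bset (Lc ^ m), wt (Lc ^ m) b * fullSum (stKc μ ν N ω (GP (Lc ^ m) b) (GQ (Lc ^ m) b))| ≤ U)
    {ε : ℝ} (hε : 0 < ε) :
    OneShotRepresentation Lc F 𝒯 (Finset.univ : Finset (BfIdx × K)) (cpCoeff N ω) μ ν Bset wt
      (fun b p n w => stP μ ν (GP n b p) p.1 w) (fun b p n w => stQ μ ν (GQ n b p) p.1 w) M (U + ε) := by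
  intro m hm
  have hU' : ∀ m : ℕ, 1 ≤ m → |composedCoeff (fun j k => if j = 0 then F (m2Tensor (𝒯 k)) else 0) m -
      ∑ b ∈ Bset (Lc ^ m), wt (Lc ^ m) b * fullSum (stKc μ ν N ω (GP (Lc ^ m) b) (GQ (Lc ^ m) b))| ≤ U := by
    intro m hm
    rw [composedCoeff_head _ hm]
    exact hU m hm
  have h := hident_of_slotFullSum_avg hμν hL hwt0 hwt1 hR' hS' hδ hFtail hGtail hU' hε m hm
  rw [composedCoeff_head _ hm] at h
  exact h

/-! ## §2 The scale-wise slot-families walls -/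

/-- **THE SCALE-WISE SLOT-FAMILIES WALL**: `HidentScalewise.oneLoopDrift_of_scalewise` at the copy-enlarged realised table
(`SquareTableSlots.hdeg_cp`, `hval_cp`) with the slot legs and the slot-wise adapters — an2's scale-wise one-loop data, the six graded rows of
every slot kernel per base point, window data, (I2-rep) for the slot legs ⟹ `OneLoopDrift` at `kappaBal N·transverseValue`.  Subject to the
READING CLAUSE of the header; nothing of Bałaban asserted. [folklore] -/
theorem oneLoopDrift_of_slotRows_scalewise {β : HBeta} (Sβ : B12Beta.OneLoopSplit β) (hμν : μ ≠ ν) {N : ℝ} (hN : N ≠ 0)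
    {Lc : ℕ} [NeZero Lc] (hL : 2 ≤ Lc) {ω : BfIdx → K → ℝ} (hω : ∀ i, ∑ κ, ω i κ = 1)
    (T 𝒯 : ℕ → EKer 4) (hTA : ∀ j c e, AbsMoment₂ (T j c e)) (hT0 : ∀ j c e, HasSum (T j c e) 0)
    (hT1 : ∀ j c e (ρ : Fin 4), HasSum (fun t : Fin 4 → ℤ => t ρ • T j c e t) 0)
    (F : Tensor4 → ℝ) (hFadd : ∀ A B, F (A + B) = F A + F B) (hβ : ∀ j, Sβ.β0 j = F (m2Tensor (T j)))
    (htel : HessianTelescoping Lc T 𝒯)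
    {Bset : ℕ → Finset κB} {wt : ℕ → κB → ℝ} {GP GQ : ℕ → κB → BfIdx × K → Pt → ℝ} {D A : ℕ → ℝ}
    (hD : ∀ j, 0 ≤ D j) (hA : ∀ j, 0 ≤ A j) {δ U cc : ℝ} {M : ℕ → ℕ} (hδ : 0 < δ)
    (hwt0 : ∀ n : ℕ, 2 ≤ n → ∀ b ∈ Bset n, 0 ≤ wt n b) (hwt1 : ∀ n : ℕ, 2 ≤ n → ∑ b ∈ Bset n, wt n b = 1)
    (hc : 1 ≤ cc) (hM : ∀ L : ℕ, 2 ≤ L → 1 ≤ M L ∧ (L : ℝ) ≤ cc * M L) (hML : ∀ L : ℕ, 2 ≤ L → M L ≤ L)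
    (hWP : ∀ n : ℕ, 2 ≤ n → ∀ b ∈ Bset n, ∀ p, WindowRows μ ν D n (GP n b p))
    (hWQ : ∀ n : ℕ, 2 ≤ n → ∀ b ∈ Bset n, ∀ p, WindowRows μ ν D n (GQ n b p))
    (hDP : ∀ n : ℕ, 2 ≤ n → ∀ b ∈ Bset n, ∀ p, DecayRows μ ν A δ n (GP n b p))
    (hDQ : ∀ n : ℕ, 2 ≤ n → ∀ b ∈ Bset n, ∀ p, DecayRows μ ν A δ n (GQ n b p))
    (hrep : OneShotRepresentation Lc F 𝒯 (Finset.univ : Finset (BfIdx × K)) (cpCoeff N ω) μ ν Bset wt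
      (fun b p n w => stP μ ν (GP n b p) p.1 w) (fun b p n w => stQ μ ν (GQ n b p) p.1 w) M U) :
    OneLoopDrift (B12Normalization.stepBal N Lc)
      (constA (|kappaBal N| * 24 + |kappaBal N| * 110592) (bubbleConst Finset.univ (cpCoeff N ω) (cpP hμν) (cpQ hμν))
          ((80 * (∑ p ∈ (Finset.univ : Finset (BfIdx × K)), |cpCoeff N ω p| *
              (A ((bfP hμν p.1).a - 2) * (A ((bfQ hμν p.1).a - 2) * 2 ^ (bfQ hμν p.1).a))) * (1 + cc / δ) + U) +
            80 * ∑ p ∈ (Finset.univ : Finset (BfIdx × K)), |cpCoeff N ω p| *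
              ((((bfP hμν p.1).A + (bfP hμν p.1).B) * D ((bfQ hμν p.1).a - 2) +
                  D ((bfP hμν p.1).a - 2) * ((bfQ hμν p.1).A + (bfQ hμν p.1).B) +
                D ((bfP hμν p.1).a - 2) * D ((bfQ hμν p.1).a - 2))))
          cc (kappaBal N * transverseValue)) Sβ.β0 :=
  have hR' : ∀ p ∈ (Finset.univ : Finset (BfIdx × K)), 0 ≤ A ((bfP hμν p.1).a - 2) := fun p _ => hA _
  have hS' : ∀ p ∈ (Finset.univ : Finset (BfIdx × K)), 0 ≤ A ((bfQ hμν p.1).a - 2) * 2 ^ (bfQ hμν p.1).a :=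
    fun p _ => mul_nonneg (hA _) (by positivity)
  oneLoopDrift_of_scalewise Sβ (hdeg_cp hμν) hμν hN (hval_cp hμν N hω) hL T 𝒯 hTA hT0 hT1 F hFadd hβ htel hwt0 hwt1
    (fun _ _ => hD _) (fun _ _ => hD _) hR' hS' hδ hc hM hML (hF_slots_avg hμν hL hML hD hWP) (hG_slots_avg hμν hL hML hD hWQ)
    (hFtail_slots_avg hμν hA hDP hL) (hGtail_slots_avg hμν hA hδ (fun L hL2 => (hM L hL2).1) hDQ hL) hrep

/-- **THE SCALE-WISE SLOT-FAMILIES WALL FROM A ONE-SHOT FULL-SUM COMPARISON** ((I2-rep) supplied by §1 at `U + 1`). [folklore] -/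
theorem oneLoopDrift_of_slotFullSum_scalewise {β : HBeta} (Sβ : B12Beta.OneLoopSplit β) (hμν : μ ≠ ν) {N : ℝ} (hN : N ≠ 0)
    {Lc : ℕ} [NeZero Lc] (hL : 2 ≤ Lc) {ω : BfIdx → K → ℝ} (hω : ∀ i, ∑ κ, ω i κ = 1)
    (T 𝒯 : ℕ → EKer 4) (hTA : ∀ j c e, AbsMoment₂ (T j c e)) (hT0 : ∀ j c e, HasSum (T j c e) 0)
    (hT1 : ∀ j c e (ρ : Fin 4), HasSum (fun t : Fin 4 → ℤ => t ρ • T j c e t) 0)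
    (F : Tensor4 → ℝ) (hFadd : ∀ A B, F (A + B) = F A + F B) (hβ : ∀ j, Sβ.β0 j = F (m2Tensor (T j)))
    (htel : HessianTelescoping Lc T 𝒯)
    {Bset : ℕ → Finset κB} {wt : ℕ → κB → ℝ} {GP GQ : ℕ → κB → BfIdx × K → Pt → ℝ} {D A : ℕ → ℝ}
    (hD : ∀ j, 0 ≤ D j) (hA : ∀ j, 0 ≤ A j) {δ U cc : ℝ} {M : ℕ → ℕ} (hδ : 0 < δ)
    (hwt0 : ∀ n : ℕ, 2 ≤ n → ∀ b ∈ Bset n, 0 ≤ wt n b) (hwt1 : ∀ n : ℕ, 2 ≤ n → ∑ b ∈ Bset n, wt n b = 1)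
    (hc : 1 ≤ cc) (hM : ∀ L : ℕ, 2 ≤ L → 1 ≤ M L ∧ (L : ℝ) ≤ cc * M L) (hML : ∀ L : ℕ, 2 ≤ L → M L ≤ L)
    (hWP : ∀ n : ℕ, 2 ≤ n → ∀ b ∈ Bset n, ∀ p, WindowRows μ ν D n (GP n b p))
    (hWQ : ∀ n : ℕ, 2 ≤ n → ∀ b ∈ Bset n, ∀ p, WindowRows μ ν D n (GQ n b p))
    (hDP : ∀ n : ℕ, 2 ≤ n → ∀ b ∈ Bset n, ∀ p, DecayRows μ ν A δ n (GP n b p))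
    (hDQ : ∀ n : ℕ, 2 ≤ n → ∀ b ∈ Bset n, ∀ p, DecayRows μ ν A δ n (GQ n b p))
    (hU : ∀ m : ℕ, 1 ≤ m →
      |F (m2Tensor (𝒯 m)) - ∑ b ∈ Bset (Lc ^ m), wt (Lc ^ m) b * fullSum (stKc μ ν N ω (GP (Lc ^ m) b) (GQ (Lc ^ m) b))| ≤ U) :
    OneLoopDrift (B12Normalization.stepBal N Lc)
      (constA (|kappaBal N| * 24 + |kappaBal N| * 110592) (bubbleConst Finset.univ (cpCoeff N ω) (cpP hμν) (cpQ hμν))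
          ((80 * (∑ p ∈ (Finset.univ : Finset (BfIdx × K)), |cpCoeff N ω p| *
              (A ((bfP hμν p.1).a - 2) * (A ((bfQ hμν p.1).a - 2) * 2 ^ (bfQ hμν p.1).a))) * (1 + cc / δ) + (U + 1)) +
            80 * ∑ p ∈ (Finset.univ : Finset (BfIdx × K)), |cpCoeff N ω p| *
              ((((bfP hμν p.1).A + (bfP hμν p.1).B) * D ((bfQ hμν p.1).a - 2) +
                  D ((bfP hμν p.1).a - 2) * ((bfQ hμν p.1).A + (bfQ hμν p.1).B) +
                D ((bfP hμν p.1).a - 2) * D ((bfQ hμν p.1).a - 2))))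
          cc (kappaBal N * transverseValue)) Sβ.β0 :=
  have hR' : ∀ p ∈ (Finset.univ : Finset (BfIdx × K)), 0 ≤ A ((bfP hμν p.1).a - 2) := fun p _ => hA _
  have hS' : ∀ p ∈ (Finset.univ : Finset (BfIdx × K)), 0 ≤ A ((bfQ hμν p.1).a - 2) * 2 ^ (bfQ hμν p.1).a :=
    fun p _ => mul_nonneg (hA _) (by positivity)
  oneLoopDrift_of_slotRows_scalewise Sβ hμν hN hL hω T 𝒯 hTA hT0 hT1 F hFadd hβ htel hD hA hδ hwt0 hwt1 hc hM hML hWP hWQ hDP hDQ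
    (oneShotRepresentation_of_slotFullSum hμν hL hwt0 hwt1 hR' hS' hδ (hFtail_slots_avg hμν hA hDP hL)
      (hGtail_slots_avg hμν hA hδ (fun L hL2 => (hM L hL2).1) hDQ hL) hU one_pos)

/-- **THE END STATEMENT FROM THE SCALE-WISE SLOT-FAMILIES WALL**: `HidentScalewise.endpointExistence_of_scalewise_remainderConst` at the
copy-enlarged realised table with the slot legs; downstream binders verbatim.  Conditional end statement; NOT the continuum limit, NOT Clay.
[folklore] -/
theorem endpointExistence_of_slotRows_scalewise_remainderConst {β : HBeta} {Cn : B12.Construction} (hgen : ForwardGenerated Cn β)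
    (Sβ : B12Beta.OneLoopSplit β) (hμν : μ ≠ ν) {N : ℝ} (hN : N ≠ 0)
    {Lc : ℕ} [NeZero Lc] (hL : 2 ≤ Lc) {ω : BfIdx → K → ℝ} (hω : ∀ i, ∑ κ, ω i κ = 1)
    (T 𝒯 : ℕ → EKer 4) (hTA : ∀ j c e, AbsMoment₂ (T j c e)) (hT0 : ∀ j c e, HasSum (T j c e) 0)
    (hT1 : ∀ j c e (ρ : Fin 4), HasSum (fun t : Fin 4 → ℤ => t ρ • T j c e t) 0)
    (F : Tensor4 → ℝ) (hFadd : ∀ A B, F (A + B) = F A + F B) (hβ : ∀ j, Sβ.β0 j = F (m2Tensor (T j)))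
    (htel : HessianTelescoping Lc T 𝒯)
    {Bset : ℕ → Finset κB} {wt : ℕ → κB → ℝ} {GP GQ : ℕ → κB → BfIdx × K → Pt → ℝ} {D A : ℕ → ℝ}
    (hD : ∀ j, 0 ≤ D j) (hA : ∀ j, 0 ≤ A j) {δ U cc : ℝ} {M : ℕ → ℕ} (hδ : 0 < δ)
    (hwt0 : ∀ n : ℕ, 2 ≤ n → ∀ b ∈ Bset n, 0 ≤ wt n b) (hwt1 : ∀ n : ℕ, 2 ≤ n → ∑ b ∈ Bset n, wt n b = 1)
    (hc : 1 ≤ cc) (hM : ∀ L : ℕ, 2 ≤ L → 1 ≤ M L ∧ (L : ℝ) ≤ cc * M L) (hML : ∀ L : ℕ, 2 ≤ L → M L ≤ L)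
    (hWP : ∀ n : ℕ, 2 ≤ n → ∀ b ∈ Bset n, ∀ p, WindowRows μ ν D n (GP n b p))
    (hWQ : ∀ n : ℕ, 2 ≤ n → ∀ b ∈ Bset n, ∀ p, WindowRows μ ν D n (GQ n b p))
    (hDP : ∀ n : ℕ, 2 ≤ n → ∀ b ∈ Bset n, ∀ p, DecayRows μ ν A δ n (GP n b p))
    (hDQ : ∀ n : ℕ, 2 ≤ n → ∀ b ∈ Bset n, ∀ p, DecayRows μ ν A δ n (GQ n b p))
    (hrep : OneShotRepresentation Lc F 𝒯 (Finset.univ : Finset (BfIdx × K)) (cpCoeff N ω) μ ν Bset wt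
      (fun b p n w => stP μ ν (GP n b p) p.1 w) (fun b p n w => stQ μ ν (GQ n b p) p.1 w) M U)
    {rr γ₀ β' : ℝ} (hγ₀ : 0 < γ₀) (hrem : RemainderConst Sβ γ₀ rr) (hr : rr ≤ B12Normalization.stepBal N Lc)
    (hβ' : 0 ≤ β') (hcont : BetaContH γ₀ β) (hup : BetaUpperH β' γ₀ β) : EndpointExistence Cn :=
  have hR' : ∀ p ∈ (Finset.univ : Finset (BfIdx × K)), 0 ≤ A ((bfP hμν p.1).a - 2) := fun p _ => hA _
  have hS' : ∀ p ∈ (Finset.univ : Finset (BfIdx × K)), 0 ≤ A ((bfQ hμν p.1).a - 2) * 2 ^ (bfQ hμν p.1).a :=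
    fun p _ => mul_nonneg (hA _) (by positivity)
  endpointExistence_of_scalewise_remainderConst hgen Sβ (hdeg_cp hμν) hμν hN (hval_cp hμν N hω) hL T 𝒯 hTA hT0 hT1 F hFadd hβ htel
    hwt0 hwt1 (fun _ _ => hD _) (fun _ _ => hD _) hR' hS' hδ hc hM hML (hF_slots_avg hμν hL hML hD hWP) (hG_slots_avg hμν hL hML hD hWQ)
    (hFtail_slots_avg hμν hA hDP hL) (hGtail_slots_avg hμν hA hδ (fun L hL2 => (hM L hL2).1) hDQ hL) hrep hγ₀ hrem hr hβ' hcont hup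

/-- **… with (T0)/(T1) from the two symmetries of the one-step Hessian kernels** (backward divergence-freeness + midpoint inversion;
`HidentScalewise.endpointExistence_of_scalewise_remainderConst_of_symmetries`). [folklore] -/
theorem endpointExistence_of_slotRows_scalewise_remainderConst_of_symmetries {β : HBeta} {Cn : B12.Construction}
    (hgen : ForwardGenerated Cn β) (Sβ : B12Beta.OneLoopSplit β) (hμν : μ ≠ ν) {N : ℝ} (hN : N ≠ 0)
    {Lc : ℕ} [NeZero Lc] (hL : 2 ≤ Lc) {ω : BfIdx → K → ℝ} (hω : ∀ i, ∑ κ, ω i κ = 1)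
    (T 𝒯 : ℕ → EKer 4) (hTA : ∀ j c e, AbsMoment₂ (T j c e))
    (hdiv : ∀ j (ν' : Fin 4) (x : Fin 4 → ℤ), ∑ μ', (T j μ' ν' x - T j μ' ν' (x - Pi.single μ' 1)) = 0)
    (hinv : ∀ j (μ' ν' : Fin 4) (y : Fin 4 → ℤ), T j μ' ν' ((Pi.single ν' 1 - Pi.single μ' 1) - y) = T j μ' ν' y)
    (F : Tensor4 → ℝ) (hFadd : ∀ A B, F (A + B) = F A + F B) (hβ : ∀ j, Sβ.β0 j = F (m2Tensor (T j)))
    (htel : HessianTelescoping Lc T 𝒯)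
    {Bset : ℕ → Finset κB} {wt : ℕ → κB → ℝ} {GP GQ : ℕ → κB → BfIdx × K → Pt → ℝ} {D A : ℕ → ℝ}
    (hD : ∀ j, 0 ≤ D j) (hA : ∀ j, 0 ≤ A j) {δ U cc : ℝ} {M : ℕ → ℕ} (hδ : 0 < δ)
    (hwt0 : ∀ n : ℕ, 2 ≤ n → ∀ b ∈ Bset n, 0 ≤ wt n b) (hwt1 : ∀ n : ℕ, 2 ≤ n → ∑ b ∈ Bset n, wt n b = 1)
    (hc : 1 ≤ cc) (hM : ∀ L : ℕ, 2 ≤ L → 1 ≤ M L ∧ (L : ℝ) ≤ cc * M L) (hML : ∀ L : ℕ, 2 ≤ L → M L ≤ L)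
    (hWP : ∀ n : ℕ, 2 ≤ n → ∀ b ∈ Bset n, ∀ p, WindowRows μ ν D n (GP n b p))
    (hWQ : ∀ n : ℕ, 2 ≤ n → ∀ b ∈ Bset n, ∀ p, WindowRows μ ν D n (GQ n b p))
    (hDP : ∀ n : ℕ, 2 ≤ n → ∀ b ∈ Bset n, ∀ p, DecayRows μ ν A δ n (GP n b p))
    (hDQ : ∀ n : ℕ, 2 ≤ n → ∀ b ∈ Bset n, ∀ p, DecayRows μ ν A δ n (GQ n b p))
    (hrep : OneShotRepresentation Lc F 𝒯 (Finset.univ : Finset (BfIdx × K)) (cpCoeff N ω) μ ν Bset wt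
      (fun b p n w => stP μ ν (GP n b p) p.1 w) (fun b p n w => stQ μ ν (GQ n b p) p.1 w) M U)
    {rr γ₀ β' : ℝ} (hγ₀ : 0 < γ₀) (hrem : RemainderConst Sβ γ₀ rr) (hr : rr ≤ B12Normalization.stepBal N Lc)
    (hβ' : 0 ≤ β') (hcont : BetaContH γ₀ β) (hup : BetaUpperH β' γ₀ β) : EndpointExistence Cn :=
  have hR' : ∀ p ∈ (Finset.univ : Finset (BfIdx × K)), 0 ≤ A ((bfP hμν p.1).a - 2) := fun p _ => hA _
  have hS' : ∀ p ∈ (Finset.univ : Finset (BfIdx × K)), 0 ≤ A ((bfQ hμν p.1).a - 2) * 2 ^ (bfQ hμν p.1).a :=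
    fun p _ => mul_nonneg (hA _) (by positivity)
  endpointExistence_of_scalewise_remainderConst_of_symmetries hgen Sβ (hdeg_cp hμν) hμν hN (hval_cp hμν N hω) hL T 𝒯 hTA hdiv hinv
    F hFadd hβ htel hwt0 hwt1 (fun _ _ => hD _) (fun _ _ => hD _) hR' hS' hδ hc hM hML (hF_slots_avg hμν hL hML hD hWP)
    (hG_slots_avg hμν hL hML hD hWQ) (hFtail_slots_avg hμν hA hDP hL) (hGtail_slots_avg hμν hA hδ (fun L hL2 => (hM L hL2).1) hDQ hL)
    hrep hγ₀ hrem hr hβ' hcont hup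

/-- **THE END STATEMENT FROM A ONE-SHOT FULL-SUM COMPARISON** ((I2-rep) supplied by §1 at `U + 1`).  Conditional end statement; NOT the
continuum limit, NOT Clay. [folklore] -/
theorem endpointExistence_of_slotFullSum_scalewise_remainderConst {β : HBeta} {Cn : B12.Construction}
    (hgen : ForwardGenerated Cn β) (Sβ : B12Beta.OneLoopSplit β) (hμν : μ ≠ ν) {N : ℝ} (hN : N ≠ 0)
    {Lc : ℕ} [NeZero Lc] (hL : 2 ≤ Lc) {ω : BfIdx → K → ℝ} (hω : ∀ i, ∑ κ, ω i κ = 1)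
    (T 𝒯 : ℕ → EKer 4) (hTA : ∀ j c e, AbsMoment₂ (T j c e)) (hT0 : ∀ j c e, HasSum (T j c e) 0)
    (hT1 : ∀ j c e (ρ : Fin 4), HasSum (fun t : Fin 4 → ℤ => t ρ • T j c e t) 0)
    (F : Tensor4 → ℝ) (hFadd : ∀ A B, F (A + B) = F A + F B) (hβ : ∀ j, Sβ.β0 j = F (m2Tensor (T j)))
    (htel : HessianTelescoping Lc T 𝒯)
    {Bset : ℕ → Finset κB} {wt : ℕ → κB → ℝ} {GP GQ : ℕ → κB → BfIdx × K → Pt → ℝ} {D A : ℕ → ℝ}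
    (hD : ∀ j, 0 ≤ D j) (hA : ∀ j, 0 ≤ A j) {δ U cc : ℝ} {M : ℕ → ℕ} (hδ : 0 < δ)
    (hwt0 : ∀ n : ℕ, 2 ≤ n → ∀ b ∈ Bset n, 0 ≤ wt n b) (hwt1 : ∀ n : ℕ, 2 ≤ n → ∑ b ∈ Bset n, wt n b = 1)
    (hc : 1 ≤ cc) (hM : ∀ L : ℕ, 2 ≤ L → 1 ≤ M L ∧ (L : ℝ) ≤ cc * M L) (hML : ∀ L : ℕ, 2 ≤ L → M L ≤ L)
    (hWP : ∀ n : ℕ, 2 ≤ n → ∀ b ∈ Bset n, ∀ p, WindowRows μ ν D n (GP n b p))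
    (hWQ : ∀ n : ℕ, 2 ≤ n → ∀ b ∈ Bset n, ∀ p, WindowRows μ ν D n (GQ n b p))
    (hDP : ∀ n : ℕ, 2 ≤ n → ∀ b ∈ Bset n, ∀ p, DecayRows μ ν A δ n (GP n b p))
    (hDQ : ∀ n : ℕ, 2 ≤ n → ∀ b ∈ Bset n, ∀ p, DecayRows μ ν A δ n (GQ n b p))
    (hU : ∀ m : ℕ, 1 ≤ m →
      |F (m2Tensor (𝒯 m)) - ∑ b ∈ Bset (Lc ^ m), wt (Lc ^ m) b * fullSum (stKc μ ν N ω (GP (Lc ^ m) b) (GQ (Lc ^ m) b))| ≤ U)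
    {rr γ₀ β' : ℝ} (hγ₀ : 0 < γ₀) (hrem : RemainderConst Sβ γ₀ rr) (hr : rr ≤ B12Normalization.stepBal N Lc)
    (hβ' : 0 ≤ β') (hcont : BetaContH γ₀ β) (hup : BetaUpperH β' γ₀ β) : EndpointExistence Cn :=
  have hR' : ∀ p ∈ (Finset.univ : Finset (BfIdx × K)), 0 ≤ A ((bfP hμν p.1).a - 2) := fun p _ => hA _
  have hS' : ∀ p ∈ (Finset.univ : Finset (BfIdx × K)), 0 ≤ A ((bfQ hμν p.1).a - 2) * 2 ^ (bfQ hμν p.1).a :=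
    fun p _ => mul_nonneg (hA _) (by positivity)
  endpointExistence_of_slotRows_scalewise_remainderConst hgen Sβ hμν hN hL hω T 𝒯 hTA hT0 hT1 F hFadd hβ htel hD hA hδ hwt0 hwt1 hc hM
    hML hWP hWQ hDP hDQ
    (oneShotRepresentation_of_slotFullSum hμν hL hwt0 hwt1 hR' hS' hδ (hFtail_slots_avg hμν hA hDP hL)
      (hGtail_slots_avg hμν hA hδ (fun L hL2 => (hM L hL2).1) hDQ hL) hU one_pos)
    hγ₀ hrem hr hβ' hcont hup

/-! ## Example -/

/-- the marginal family supported on `j = 0` carries any prescribed sequence as its composed coefficient (here at `m = 3`). [folklore] -/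
example (a : ℕ → ℝ) : composedCoeff (fun j k => if j = 0 then a k else 0) 3 = a 3 := composedCoeff_head a (by norm_num)

end Literature.MathematicalPhysics.QuantumFieldTheory.Balaban1983to89.Beta.SquareTableSlotsScalewise
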